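import Summits.Ventures.PercRepro.RankLevelSetPerElemSkeleton
import Summits.Ventures.PercRepro.RankLevelSetPerElemThreeClass

/-! # RankLevelSetPerElemFour — (★★) AT LEVEL `4` AND MONO'S STEP `j = 4` FOR EVERY FINITE MATROID; THE STEP
`k = 5` OF (ABS-star) AT A PARALLEL ELEMENT; (★★) AND MONO ON EVERY MATROID WITH AT MOST `11` ELEMENTS AND ON
EVERY MATROID OF RANK AT MOST `6` (night-1 g36; dossier §48.12; on `RankLevelSetPerElemSkeleton` and
`RankLevelSetPerElemThreeClass`)

At level `4` every absorbing member has a circuit with at least `3` elements (`fundCircuit_ncard_absorb`), so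
`#K + 1 ≥ 4` always and the per-circuit chain `perElemAt_of_coloopFree_of_circuits` gives (★★) at level `4` on
every coloop-free matroid at every element in no parallel pair with `10 ≤ #E` (**`perElemAt_four_of_coloopFree`**).
The reductions of `RankLevelSetPerElemReduce` (a loop kills everything; a parallel pair sends level `4` to level
`3` of `M ／ {u} ＼ {v}` — `perElemAt_three` — or to `D_3 ≤ D_4` of the minor — `biIndepCount_three_le_four`; a
coloop `x ≠ y` to the levels `3` and `4` of `M ＼ {x}`, the latter by induction or the middle equality on `9`
elements; at a coloop itself the inequality is an equality) give **`perElemAt_four`** for every finite matroid and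
element with `10 ≤ #E`, hence **`mono_step_four : (#E − 4)·D_4 ≤ 5·D_5`**, `biIndepCount_four_le_five`,
**`absorbStar_step_five_of_parallel`** (g32's identity on the minor, `11 ≤ #E`), and the class theorems
**`biIndepPerElem_of_ncard_le_eleven`**, **`biIndepMono_of_ncard_le_eleven`**, **`biIndepPerElem_of_eRank_le_six`**,
**`biIndepMono_of_eRank_le_six`**. Every declaration has a docstring; imports: the cell's own modules and Mathlib
only. Axioms: standard. -/

namespace PercRepro

open Set Matroid

variable {α : Type} (M : Matroid α) [M.Finite]

/-! ## The coloop-free case -/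

/-- **(★★) AT LEVEL `4` ON A COLOOP-FREE MATROID AT AN ELEMENT IN NO PARALLEL PAIR** (`10 ≤ #E`): every circuit of
an absorbing `4`-set has at least `3` elements, so every circuit class is covered by the chain. -/
theorem perElemAt_four_of_coloopFree (hcol : ∀ e, ¬ M.IsColoop e) {y : α} (hy : y ∈ M.E)
    (hnp : ∀ z, z ≠ y → y ∉ M.closure {z}) (hn : 10 ≤ M.E.ncard) :
    {Z ∈ biIndep M 4 | y ∉ Z}.ncard ≤ {Q ∈ biIndep M 5 | y ∈ Q}.ncard := by
  obtain ⟨z₀, hz₀⟩ : (M.E \ {y}).Nonempty := by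
    rw [← Set.ncard_pos (M.ground_finite.subset Set.sdiff_subset), Set.ncard_sdiff_singleton_of_mem hy]
    omega
  have hz₀y : z₀ ≠ y := by simpa using hz₀.2
  refine perElemAt_of_coloopFree_of_circuits M hcol hy (by norm_num) (by omega) ?_
  intro Z₀ hZ₀
  have := (fundCircuit_ncard_absorb M hy hnp hz₀y hZ₀).1
  omega

/-! ## The reductions -/

/-- **(★★) AT LEVEL `4` FOR EVERY FINITE MATROID ON `n` ELEMENTS FOLLOWS FROM THE COLOOP-FREE CASE** (the auxiliary
form, by strong induction on `n`). -/
theorem perElemAt_four_of_simple_aux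
    (H : ∀ (M' : Matroid α) [M'.Finite], (∀ e, ¬ M'.IsLoop e) → (∀ u v, ¬ ParallelPair M' u v) →
      (∀ e, ¬ M'.IsColoop e) → ∀ y ∈ M'.E, 10 ≤ M'.E.ncard →
        {Z ∈ biIndep M' 4 | y ∉ Z}.ncard ≤ {Q ∈ biIndep M' 5 | y ∈ Q}.ncard) :
    ∀ n : ℕ, ∀ (M' : Matroid α) [M'.Finite], M'.E.ncard = n → ∀ y ∈ M'.E, 10 ≤ n →
      {Z ∈ biIndep M' 4 | y ∉ Z}.ncard ≤ {Q ∈ biIndep M' 5 | y ∈ Q}.ncard := by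
  intro n
  induction n using Nat.strong_induction_on with
  | _ n ih =>
    intro M' _ hn y hy h10
    -- a loop anywhere
    by_cases hloop : ∃ ℓ, M'.IsLoop ℓ
    · obtain ⟨ℓ, hℓ⟩ := hloop
      have : {Z ∈ biIndep M' 4 | y ∉ Z} = ∅ := by
        rw [biIndep_eq_empty_of_isLoop M' hℓ 4]
        ext Z; simp
      rw [this, Set.ncard_empty]
      exact Nat.zero_le _
    simp only [not_exists] at hloop
    -- a parallel pair anywhere
    by_cases hpar : ∃ u v, ParallelPair M' u v
    · obtain ⟨u, v, huv⟩ := hpar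
      haveI := contract_delete_finite M' u v
      have hcard := ncard_ground_contract_delete M' huv
      have hD : ∀ {u v : α} (h : ParallelPair M' u v),
          biIndepCount ((M'.contract {u}).delete {v}) 3 ≤ biIndepCount ((M'.contract {u}).delete {v}) 4 := by
        intro u v h
        haveI := contract_delete_finite M' u v
        have hc := ncard_ground_contract_delete M' h
        exact biIndepCount_three_le_four ((M'.contract {u}).delete {v}) (by rw [hc]; omega)
      by_cases hyu : y = u
      · subst hyu
        exact perElem_succ_of_parallel_self M' huv 3 (hD huv)
      by_cases hyv : y = v
      · subst hyv
        exact perElem_succ_of_parallel_self M' huv.symm 3 (hD huv.symm)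
      · have hyN : y ∈ ((M'.contract {u}).delete {v}).E := by
          rw [ground_contract_delete]
          exact ⟨hy, by simp only [Set.mem_insert_iff, Set.mem_singleton_iff, not_or]; exact ⟨hyu, hyv⟩⟩
        exact perElem_succ_of_parallel_other M' huv hyu hyv 3
          (perElemAt_three ((M'.contract {u}).delete {v}) hyN (by rw [hcard]; omega))
    simp only [not_exists] at hpar
    -- a coloop anywhere
    by_cases hcol : ∃ x, M'.IsColoop x
    · obtain ⟨x, hx⟩ := hcol
      haveI := delete_finite' M' x
      have hcard : (M'.delete {x}).E.ncard = n - 1 := by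
        rw [Matroid.delete_ground, Set.ncard_sdiff_singleton_of_mem hx.mem_ground, hn]
      by_cases hyx : y = x
      · subst hyx
        exact (perElem_coloop_self M' hx 4).le
      · have hyM : y ∈ (M'.delete {x}).E := by
          rw [Matroid.delete_ground]
          exact ⟨hy, by simpa using hyx⟩
        refine perElem_succ_of_coloop M' hx hyx 3 (perElemAt_three (M'.delete {x}) hyM (by omega)) ?_
        rcases Nat.lt_or_ge (n - 1) 10 with h9 | h10'
        · exact (perElem_middle_eq (M'.delete {x}) hyM 4 (by omega)).le
        · exact ih (n - 1) (by omega) (M'.delete {x}) hcard y hyM h10'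
    simp only [not_exists] at hcol
    exact H M' hloop hpar hcol y hy (by omega)

/-- **(★★) AT LEVEL `4` FOR EVERY FINITE MATROID AND EVERY ELEMENT** (`10 ≤ #E`):
`#{Z ∈ D_4 : y ∉ Z} ≤ #{Q ∈ D_5 : y ∈ Q}`. -/
theorem perElemAt_four {y : α} (hy : y ∈ M.E) (hn : 10 ≤ M.E.ncard) :
    {Z ∈ biIndep M 4 | y ∉ Z}.ncard ≤ {Q ∈ biIndep M 5 | y ∈ Q}.ncard :=
  perElemAt_four_of_simple_aux (fun M' _ hl hp hc y hy hn => perElemAt_four_of_coloopFree M' hc hy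
    (fun _ hz => notMem_closure_singleton_of_no_partner M' hy (hl y) (hp y) hz) hn) M.E.ncard M rfl y hy hn

/-- **MONO'S STEP `j = 4` FOR EVERY FINITE MATROID**: `(#E − 4) · D_4 ≤ 5 · D_5` for `10 ≤ #E`. -/
theorem mono_step_four (hn : 10 ≤ M.E.ncard) :
    (M.E.ncard - 4) * biIndepCount M 4 ≤ 5 * biIndepCount M 5 :=
  mono_step_of_perElemAt M 4 (fun _ hy => perElemAt_four M hy hn)

/-- `D_4 ≤ D_5` on `10 ≤ #E` elements. -/
lemma biIndepCount_four_le_five (hn : 10 ≤ M.E.ncard) : biIndepCount M 4 ≤ biIndepCount M 5 := by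
  have h := mono_step_four M hn
  have h5 : 5 * biIndepCount M 4 ≤ (M.E.ncard - 4) * biIndepCount M 4 :=
    Nat.mul_le_mul_right _ (by omega)
  omega

/-! ## The step `k = 5` of (ABS-star) at an element of a parallel pair -/

/-- **THE STEP `k = 5` OF (ABS-star) AT AN ELEMENT OF A PARALLEL PAIR**: for a parallel pair `{y, z}` and
`11 ≤ #E`, `(#E − 6) · A^y_5 ≤ 5 · A^y_6` — Mono's step `j = 4` of `M ／ {y} ＼ {z}` (`mono_step_four` on
`#E − 2 ≥ 10` elements), and on `9` elements the symmetry `D_4(N) = D_5(N)`. -/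
theorem absorbStar_step_five_of_parallel {y z : α} (h : ParallelPair M y z) (hn : 11 ≤ M.E.ncard) :
    (M.E.ncard - 6) * lowAbsorbCount M y 5 ≤ 5 * lowAbsorbCount M y 6 := by
  haveI := contract_delete_finite M y z
  have hcard := ncard_ground_contract_delete M h
  rw [lowAbsorbCount_succ_of_parallel_left M h 4, lowAbsorbCount_succ_of_parallel_left M h 5]
  rcases Nat.lt_or_ge M.E.ncard 12 with h11 | h12
  · have hm : M.E.ncard = 11 := by omega
    have hsym := biIndepCount_compl ((M.contract {y}).delete {z}) 4 (by rw [hcard]; omega)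
    rw [hcard, hm] at hsym
    rw [hm]
    have h5 : (11 - 2 - 4 : ℕ) = 5 := by norm_num
    rw [h5] at hsym
    rw [show (11 - 6 : ℕ) = 5 by norm_num, hsym]
  · have hstep := mono_step_four ((M.contract {y}).delete {z}) (by rw [hcard]; omega)
    rw [hcard] at hstep
    rw [show M.E.ncard - 6 = M.E.ncard - 2 - 4 by omega]
    exact hstep

/-! ## Class theorems -/

/-- **(★★) at every level `j ≤ 4`** for every finite matroid and every element, whenever `2j + 1 < #E`. -/
theorem perElemAt_le_four {y : α} (hy : y ∈ M.E) {j : ℕ} (hj : j ≤ 4) (hn : 2 * j + 1 < M.E.ncard) :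
    {Z ∈ biIndep M j | y ∉ Z}.ncard ≤ {Q ∈ biIndep M (j + 1) | y ∈ Q}.ncard := by
  rcases Nat.lt_or_ge j 4 with h3 | h4
  · exact perElemAt_le_three M hy (by omega) hn
  · have hj4 : j = 4 := by omega
    subst hj4
    exact perElemAt_four M hy (by omega)

/-- **(★★) holds on every matroid with at most `11` elements**: every level in range has `j ≤ 4`. -/
theorem biIndepPerElem_of_ncard_le_eleven (hn : M.E.ncard ≤ 11) : BiIndepPerElem M :=
  fun _ hy j hj => perElemAt_le_four M hy (by omega) hj

/-- **Mono holds on every matroid with at most `11` elements**. -/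
theorem biIndepMono_of_ncard_le_eleven (hn : M.E.ncard ≤ 11) : BiIndepMono M :=
  biIndepMono_of_perElem M (biIndepPerElem_of_ncard_le_eleven M hn)

/-- **(★★) holds on every matroid of rank at most `6`**: at a level `j ≥ 5` with `2j + 1 < #E` a bi-independent
`j`-set would have an independent complement of `#E − j ≥ 7` elements. -/
theorem biIndepPerElem_of_eRank_le_six (hr : M.eRank ≤ 6) : BiIndepPerElem M := by
  intro y hy j hj
  rcases Nat.lt_or_ge j 5 with h4 | h5
  · exact perElemAt_le_four M hy (by omega) hj
  · have hempty : biIndep M j = ∅ := by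
      refine biIndep_eq_empty_of_eRank_lt M (lt_of_le_of_lt hr ?_)
      have h7 : (7 : ℕ) ≤ M.E.ncard - j := by omega
      calc (6 : ℕ∞) < ((7 : ℕ) : ℕ∞) := by norm_num
        _ ≤ ((M.E.ncard - j : ℕ) : ℕ∞) := by exact_mod_cast h7
    have hL : {Z ∈ biIndep M j | y ∉ Z} = ∅ := by
      rw [hempty]
      ext Z
      simp
    rw [hL, Set.ncard_empty]
    exact Nat.zero_le _

/-- **Mono holds on every matroid of rank at most `6`**. -/
theorem biIndepMono_of_eRank_le_six (hr : M.eRank ≤ 6) : BiIndepMono M :=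
  biIndepMono_of_perElem M (biIndepPerElem_of_eRank_le_six M hr)

end PercRepro
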